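import Mathlib
import Literature.Computability.AlgebraicComplexity.BorderApolarityLimits

/-!
# Bi-degree `(110)`, `(210)`, `(120)` forms of a 3-tensor in coordinates: products, alternating
# arrays, slice annihilators, moving points, torus weights (vocabulary of elementary border apolarity)

Topic `Literature/Computability/AlgebraicComplexity`. Definitions (with their unfolding API) for the
elementary, torus-only border apolarity argument of Conner–Harper–Landsberg 2023, §2.3–§3, as used
by `BorderApolarityWeak.lean` (the necessary conditions in bi-degrees `(110)`, `(210)`, `(120)`),
`ApolarityGradedProducts.lean` (torus degenerations) and `BorderRankMatMulTwoApolarity.lean`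
(`R̲(⟨2,2,2⟩) = 7`). For a tensor `t : ι → κ → μ → K` the `κ`- and `μ`-slots play the roles of
`A` and `B` of the source, the `ι`-slot the role of `C`. Coordinates: `(1,1,0)`-forms (bilinear forms
on `A × B`) are `κ × μ → R`; `(2,1,0)`-forms are kept UNSYMMETRISED as arrays `κ × (κ × μ) → R`
(the coordinates `A* ⊗ A* ⊗ B*` of `BorderRankMatMulTwoCert.lean`), `(1,2,0)`-forms as
`κ × (μ × μ) → R`.

* `mulA f α`, `mulB f β` — the symmetrised products `f·α ∈ S²A* ⊗ B*`, `f·β ∈ A* ⊗ S²B*`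
  (one column block of the `(210)`/`(120)`-maps of CHL §3; `mulA f e_{a₀}` is
  `MatMulTwo.mul210Fun a₀ f`); `prodA F = F·A*`, `prodB F = F·B*`; `altA`, `altB` — alternating
  arrays (they vanish identically as forms and span, with the symmetric ones, the whole array space).
* `slicePerp t = t(C*)^⊥` — bilinear forms annihilating every `ι`-slice of `t` (CHL §2.3 (i)).
* `pt₁ v w`, `pt₂ v w`, `pt₃ v w` — values of the coordinate monomials at the `r` moving points
  `(v_ρ(ε), w_ρ(ε))` of an approximate decomposition; `vanishingL L P` — the `K(ε)`-subspace of
  forms vanishing at the points (the degree piece `I_{ijk,ε}` of their ideal, CHL §2.3), whose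
  lattice of polynomial vectors (`latt`, `BorderApolarityLimits.lean`) is described by
  `mem_latt_vanishingL_iff`.
* `perturbV`, `perturbW`, `degBound` — the generic `ε^M`-perturbation of a decomposition.
* `wt₁`, `wt₂`, `wt₃` — the weights of a one-parameter torus `(e_A, e_B)` on the three kinds of
  coordinates; `MatMulTwo.eA2`, `MatMulTwo.eB2`, `MatMulTwo.wc`, `MatMulTwo.piv` — the `2 × 2`
  data: a separating one-parameter subgroup of the torus of `GL(U) × GL(V) × GL(W)` and, for each of
  the `12` weight lines `MatMulTwo.wvZ k` of `M⟨2⟩(C*)^⊥` (`BorderRankMatMulTwoCert.lean`), its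
  weight and its pivot coordinate.

Pure definitions and `rfl`/one-line API; the mathematics is in the three files above.

## References

* A. Conner, A. Harper, J. M. Landsberg, *New lower bounds for matrix multiplication and `det₃`*,
  Forum Math. Pi 11 (2023) e17 = arXiv:1911.07981, §2.3 (i)–(iii), §2.5, §3 (the `(210)`/`(120)`
  maps), §4–§5. [ConnerHarperLandsberg2023]
-/

noncomputable section

open Polynomial Module
open scoped Polynomial BigOperators

namespace Literature.Computability.AlgebraicComplexity

namespace TensorApolarity

/-! ## Products of forms and alternating arrays -/

section Forms

variable {R : Type*} [CommRing R] {κ μ : Type*}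

/-- The symmetrised product `f·α ∈ S²A* ⊗ B*` of a `(1,1,0)`-form `f` (coefficients `κ × μ → R`)
with a `(1,0,0)`-form `α`, as an unsymmetrised array on `κ × (κ × μ)`:
`(k, k', m) ↦ f(k,m) α(k') + f(k',m) α(k)`. [cite: ConnerHarperLandsberg2023, §3 (the (210)-map)] -/
def mulA (f : κ × μ → R) (α : κ → R) : κ × (κ × μ) → R :=
  fun p => f (p.1, p.2.2) * α p.2.1 + f (p.2.1, p.2.2) * α p.1

/-- The symmetrised product `f·β ∈ A* ⊗ S²B*`, an array on `κ × (μ × μ)`: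
`(k, m, m') ↦ f(k,m) β(m') + f(k,m') β(m)`. [cite: ConnerHarperLandsberg2023, §3 (the (120)-map)] -/
def mulB (f : κ × μ → R) (β : μ → R) : κ × (μ × μ) → R :=
  fun p => f (p.1, p.2.1) * β p.2.2 + f (p.1, p.2.2) * β p.2.1

/-- Entries of `f·α`. [folklore] -/
@[simp] theorem mulA_apply (f : κ × μ → R) (α : κ → R) (k k' : κ) (m : μ) :
    mulA f α (k, (k', m)) = f (k, m) * α k' + f (k', m) * α k := rfl

/-- Entries of `f·β`. [folklore] -/
@[simp] theorem mulB_apply (f : κ × μ → R) (β : μ → R) (k : κ) (m m' : μ) :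
    mulB f β (k, (m, m')) = f (k, m) * β m' + f (k, m') * β m := rfl

/-- `f ↦ f·α` as a linear map. [cite: ConnerHarperLandsberg2023, §3] -/
def mulALin (μ : Type*) (α : κ → R) : (κ × μ → R) →ₗ[R] (κ × (κ × μ) → R) where
  toFun f := mulA f α
  map_add' f g := by ext ⟨k, k', m⟩; simp [mulA]; ring
  map_smul' c f := by ext ⟨k, k', m⟩; simp [mulA]; ring

/-- `f ↦ f·β` as a linear map. [cite: ConnerHarperLandsberg2023, §3] -/
def mulBLin (κ : Type*) (β : μ → R) : (κ × μ → R) →ₗ[R] (κ × (μ × μ) → R) where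
  toFun f := mulB f β
  map_add' f g := by ext ⟨k, m, m'⟩; simp [mulB]; ring
  map_smul' c f := by ext ⟨k, m, m'⟩; simp [mulB]; ring

/-- Unfolding lemma. [folklore] -/
@[simp] theorem mulALin_apply (α : κ → R) (f : κ × μ → R) : mulALin μ α f = mulA f α := rfl

/-- Unfolding lemma. [folklore] -/
@[simp] theorem mulBLin_apply (β : μ → R) (f : κ × μ → R) : mulBLin κ β f = mulB f β := rfl

/-- The product space `F·A*`, spanned by the `f·e_x`, `f ∈ F`, `x ∈ κ` (the image of the
`(210)`-map on `F ⊗ A*`). [cite: ConnerHarperLandsberg2023, §3 (the (210)-map)] -/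
def prodA [DecidableEq κ] (F : Submodule R (κ × μ → R)) : Submodule R (κ × (κ × μ) → R) :=
  ⨆ x : κ, F.map (mulALin μ (Pi.single x 1))

/-- The product space `F·B*` (the image of the `(120)`-map on `F ⊗ B*`).
[cite: ConnerHarperLandsberg2023, §3 (the (120)-map)] -/
def prodB [DecidableEq μ] (F : Submodule R (κ × μ → R)) : Submodule R (κ × (μ × μ) → R) :=
  ⨆ y : μ, F.map (mulBLin κ (Pi.single y 1))

/-- The generators `f·e_x` of `F·A*`. [folklore] -/
theorem mulA_single_mem_prodA [DecidableEq κ] {F : Submodule R (κ × μ → R)} {f : κ × μ → R}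
    (hf : f ∈ F) (x : κ) : mulA f (Pi.single x 1) ∈ prodA F :=
  Submodule.mem_iSup_of_mem x ⟨f, hf, rfl⟩

/-- The generators `f·e_y` of `F·B*`. [folklore] -/
theorem mulB_single_mem_prodB [DecidableEq μ] {F : Submodule R (κ × μ → R)} {f : κ × μ → R}
    (hf : f ∈ F) (y : μ) : mulB f (Pi.single y 1) ∈ prodB F :=
  Submodule.mem_iSup_of_mem y ⟨f, hf, rfl⟩

/-- `F·A*` is monotone in `F`. [folklore] -/
theorem prodA_mono [DecidableEq κ] {F G : Submodule R (κ × μ → R)} (h : F ≤ G) :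
    prodA F ≤ prodA G :=
  iSup_mono fun _ => Submodule.map_mono h

/-- `F·B*` is monotone in `F`. [folklore] -/
theorem prodB_mono [DecidableEq μ] {F G : Submodule R (κ × μ → R)} (h : F ≤ G) :
    prodB F ≤ prodB G :=
  iSup_mono fun _ => Submodule.map_mono h

/-- `F·A* ≤ W` as soon as all generators `f·e_x` lie in `W`. [folklore] -/
theorem prodA_le_iff [DecidableEq κ] {F : Submodule R (κ × μ → R)}
    {W : Submodule R (κ × (κ × μ) → R)} :
    prodA F ≤ W ↔ ∀ f ∈ F, ∀ x : κ, mulA f (Pi.single x 1) ∈ W := by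
  constructor
  · intro h f hf x
    exact h (mulA_single_mem_prodA hf x)
  · intro h
    refine iSup_le fun x => Submodule.map_le_iff_le_comap.2 fun f hf => ?_
    simpa using h f hf x

/-- `F·B* ≤ W` as soon as all generators `f·e_y` lie in `W`. [folklore] -/
theorem prodB_le_iff [DecidableEq μ] {F : Submodule R (κ × μ → R)}
    {W : Submodule R (κ × (μ × μ) → R)} :
    prodB F ≤ W ↔ ∀ f ∈ F, ∀ y : μ, mulB f (Pi.single y 1) ∈ W := by
  constructor
  · intro h f hf y
    exact h (mulB_single_mem_prodB hf y)
  · intro h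
    refine iSup_le fun y => Submodule.map_le_iff_le_comap.2 fun f hf => ?_
    simpa using h f hf y

variable (R κ μ)

/-- Alternating `(2,1,0)` arrays (antisymmetric in the two `κ`-indices, zero on the diagonal): they
vanish identically as forms `∑ g_{k k' m} a_k a_{k'} b_m`. [folklore] -/
def altA : Submodule R (κ × (κ × μ) → R) where
  carrier := {g | (∀ k k' m, g (k, (k', m)) = -g (k', (k, m))) ∧ ∀ k m, g (k, (k, m)) = 0}
  add_mem' := by
    rintro g g' ⟨hg, hg0⟩ ⟨hg', hg0'⟩
    refine ⟨fun k k' m => ?_, fun k m => ?_⟩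
    · simp only [Pi.add_apply, hg k k' m, hg' k k' m]; ring
    · simp [hg0 k m, hg0' k m]
  zero_mem' := ⟨fun _ _ _ => by simp, fun _ _ => by simp⟩
  smul_mem' := by
    rintro c g ⟨hg, hg0⟩
    refine ⟨fun k k' m => ?_, fun k m => ?_⟩
    · simp only [Pi.smul_apply, smul_eq_mul, hg k k' m]; ring
    · simp [hg0 k m]

/-- Alternating `(1,2,0)` arrays. [folklore] -/
def altB : Submodule R (κ × (μ × μ) → R) where
  carrier := {g | (∀ k m m', g (k, (m, m')) = -g (k, (m', m))) ∧ ∀ k m, g (k, (m, m)) = 0}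
  add_mem' := by
    rintro g g' ⟨hg, hg0⟩ ⟨hg', hg0'⟩
    refine ⟨fun k m m' => ?_, fun k m => ?_⟩
    · simp only [Pi.add_apply, hg k m m', hg' k m m']; ring
    · simp [hg0 k m, hg0' k m]
  zero_mem' := ⟨fun _ _ _ => by simp, fun _ _ => by simp⟩
  smul_mem' := by
    rintro c g ⟨hg, hg0⟩
    refine ⟨fun k m m' => ?_, fun k m => ?_⟩
    · simp only [Pi.smul_apply, smul_eq_mul, hg k m m']; ring
    · simp [hg0 k m]

variable {R κ μ}

/-- Membership in `altA`. [folklore] -/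
theorem mem_altA {g : κ × (κ × μ) → R} :
    g ∈ altA R κ μ ↔ (∀ k k' m, g (k, (k', m)) = -g (k', (k, m))) ∧ ∀ k m, g (k, (k, m)) = 0 :=
  Iff.rfl

/-- Membership in `altB`. [folklore] -/
theorem mem_altB {g : κ × (μ × μ) → R} :
    g ∈ altB R κ μ ↔ (∀ k m m', g (k, (m, m')) = -g (k, (m', m))) ∧ ∀ k m, g (k, (m, m)) = 0 :=
  Iff.rfl

end Forms

/-! ## Slice annihilators, moving points, the `K(ε)`-spaces of vanishing forms -/

universe u

variable {K : Type u} [Field K]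
variable {ι κ μ : Type} [Fintype ι] [Fintype κ] [Fintype μ]

/-- The annihilator `t(C*)^⊥` of the `ι`-slices of `t`: bilinear forms `f` on `A × B` with
`∑_{k,m} f(k,m) t(a,k,m) = 0` for every `a ∈ ι`. [cite: ConnerHarperLandsberg2023, §2.3 (i)] -/
def slicePerp (t : ι → κ → μ → K) : Submodule K (κ × μ → K) where
  carrier := {f | ∀ a : ι, ∑ p : κ × μ, f p * t a p.1 p.2 = 0}
  add_mem' := by
    intro f g hf hg a
    simp only [Pi.add_apply, add_mul, Finset.sum_add_distrib, hf a, hg a, add_zero]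
  zero_mem' := by intro a; simp
  smul_mem' := by
    intro c f hf a
    simp only [Pi.smul_apply, smul_eq_mul, mul_assoc, ← Finset.mul_sum, hf a, mul_zero]

omit [Fintype ι] in
/-- Membership in `t(C*)^⊥`. [folklore] -/
theorem mem_slicePerp {t : ι → κ → μ → K} {f : κ × μ → K} :
    f ∈ slicePerp t ↔ ∀ a : ι, ∑ p : κ × μ, f p * t a p.1 p.2 = 0 :=
  Iff.rfl

section Points

variable {r : ℕ}

/-- Values of the `(1,1,0)` monomials `a_k b_m` at the `ρ`-th moving point `(v_ρ, w_ρ)`.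
[cite: ConnerHarperLandsberg2023, §2.3] -/
def pt₁ (v : Fin r → κ → K[X]) (w : Fin r → μ → K[X]) : Fin r → κ × μ → K[X] :=
  fun ρ p => v ρ p.1 * w ρ p.2

/-- Values of the `(2,1,0)` monomials `a_k a_{k'} b_m` at the `ρ`-th moving point.
[cite: ConnerHarperLandsberg2023, §2.3] -/
def pt₂ (v : Fin r → κ → K[X]) (w : Fin r → μ → K[X]) : Fin r → κ × (κ × μ) → K[X] :=
  fun ρ p => v ρ p.1 * v ρ p.2.1 * w ρ p.2.2

/-- Values of the `(1,2,0)` monomials `a_k b_m b_{m'}` at the `ρ`-th moving point.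
[cite: ConnerHarperLandsberg2023, §2.3] -/
def pt₃ (v : Fin r → κ → K[X]) (w : Fin r → μ → K[X]) : Fin r → κ × (μ × μ) → K[X] :=
  fun ρ p => v ρ p.1 * w ρ p.2.1 * w ρ p.2.2

/-- Perturbing the `κ`-vectors: `v'_ρ = v_ρ + ε^M e_{x_ρ}`. [cite: ConnerHarperLandsberg2023, §2.3
("we may choose the curves such that codim I_{ijk} = r")] -/
def perturbV [DecidableEq κ] (M : ℕ) (xs : Fin r → κ) (v : Fin r → κ → K[X]) :
    Fin r → κ → K[X] :=
  fun ρ => v ρ + (X : K[X]) ^ M • (Pi.single (xs ρ) 1 : κ → K[X])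

/-- Perturbing the `μ`-vectors: `w'_ρ = w_ρ + ε^M e_{y_ρ}`. [cite: ConnerHarperLandsberg2023, §2.3] -/
def perturbW [DecidableEq μ] (M : ℕ) (ys : Fin r → μ) (w : Fin r → μ → K[X]) :
    Fin r → μ → K[X] :=
  fun ρ => w ρ + (X : K[X]) ^ M • (Pi.single (ys ρ) 1 : μ → K[X])

omit [Fintype κ] [Fintype μ] in
/-- Coordinates of the perturbed `κ`-vectors. [folklore] -/
theorem perturbV_apply [DecidableEq κ] (M : ℕ) (xs : Fin r → κ) (v : Fin r → κ → K[X])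
    (ρ : Fin r) (k : κ) :
    perturbV M xs v ρ k = v ρ k + X ^ M * (Pi.single (xs ρ) (1 : K[X]) : κ → K[X]) k := by
  simp [perturbV]

omit [Fintype κ] [Fintype μ] in
/-- Coordinates of the perturbed `μ`-vectors. [folklore] -/
theorem perturbW_apply [DecidableEq μ] (M : ℕ) (ys : Fin r → μ) (w : Fin r → μ → K[X])
    (ρ : Fin r) (m : μ) :
    perturbW M ys w ρ m = w ρ m + X ^ M * (Pi.single (ys ρ) (1 : K[X]) : μ → K[X]) m := by
  simp [perturbW]

/-- A bound on all degrees occurring in `v`, `w`. [folklore] -/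
def degBound (v : Fin r → κ → K[X]) (w : Fin r → μ → K[X]) : ℕ :=
  (Finset.univ.sup fun p : Fin r × κ => (v p.1 p.2).natDegree) ⊔
    (Finset.univ.sup fun p : Fin r × μ => (w p.1 p.2).natDegree)

/-- `degBound` bounds the degrees of the `κ`-vectors. [folklore] -/
theorem natDegree_v_le_degBound (v : Fin r → κ → K[X]) (w : Fin r → μ → K[X]) (ρ : Fin r)
    (k : κ) : (v ρ k).natDegree ≤ degBound v w := by
  refine le_trans ?_ le_sup_left
  exact Finset.le_sup (f := fun p : Fin r × κ => (v p.1 p.2).natDegree) (Finset.mem_univ (ρ, k))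

/-- `degBound` bounds the degrees of the `μ`-vectors. [folklore] -/
theorem natDegree_w_le_degBound (v : Fin r → κ → K[X]) (w : Fin r → μ → K[X]) (ρ : Fin r)
    (m : μ) : (w ρ m).natDegree ≤ degBound v w := by
  refine le_trans ?_ le_sup_right
  exact Finset.le_sup (f := fun p : Fin r × μ => (w p.1 p.2).natDegree) (Finset.mem_univ (ρ, m))

end Points

section VanishingL

variable (L : Type*) [Field L] [Algebra K[X] L] {σ : Type} [Fintype σ] {r : ℕ}

/-- Evaluation of a form with coefficients in `L = K(ε)` at the `r` moving points:
`f ↦ (∑_s f_s P_ρ(s))_ρ`. [cite: ConnerHarperLandsberg2023, §2.3] -/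
def evalL (P : Fin r → σ → K[X]) : (σ → L) →ₗ[L] (Fin r → L) where
  toFun f ρ := ∑ s, f s * algebraMap K[X] L (P ρ s)
  map_add' f g := by
    ext ρ
    simp [add_mul, Finset.sum_add_distrib]
  map_smul' c f := by
    ext ρ
    simp [Finset.mul_sum, mul_assoc]

/-- Unfolding lemma. [folklore] -/
@[simp] theorem evalL_apply (P : Fin r → σ → K[X]) (f : σ → L) (ρ : Fin r) :
    evalL L P f ρ = ∑ s, f s * algebraMap K[X] L (P ρ s) := rfl

/-- The `L`-subspace of forms vanishing at the moving points (the degree piece `I_ε` of their ideal,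
over the function field `L = K(ε)`). [cite: ConnerHarperLandsberg2023, §2.3] -/
def vanishingL (P : Fin r → σ → K[X]) : Submodule L (σ → L) :=
  LinearMap.ker (evalL L P)

variable [IsFractionRing K[X] L]

/-- A polynomial form lies in the lattice of `vanishingL` iff it vanishes at the points over `K[ε]`.
[cite: ConnerHarperLandsberg2023, §2.3] -/
theorem mem_latt_vanishingL_iff {P : Fin r → σ → K[X]} {f : σ → K[X]} :
    f ∈ latt K L (vanishingL L P) ↔ ∀ ρ, ∑ s, f s * P ρ s = 0 := by
  rw [mem_latt, vanishingL, LinearMap.mem_ker]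
  constructor
  · intro h ρ
    have hρ := congrFun h ρ
    apply IsFractionRing.injective K[X] L
    rw [map_sum, map_zero]
    simpa [polyVec, map_mul] using hρ
  · intro h
    funext ρ
    have hρ := congrArg (algebraMap K[X] L) (h ρ)
    rw [map_sum, map_zero] at hρ
    simpa [polyVec, map_mul] using hρ

end VanishingL

/-! ## Torus weights on the three kinds of coordinates -/

section Weights

variable (eA : κ → ℕ) (eB : μ → ℕ)

/-- Torus weight of the `(1,1,0)` coordinate `a_k b_m`. [cite: ConnerHarperLandsberg2023, §2.5] -/
def wt₁ : κ × μ → ℕ := fun p => eA p.1 + eB p.2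

/-- Torus weight of the `(2,1,0)` coordinate `a_k a_{k'} b_m`. [cite: ConnerHarperLandsberg2023, §2.5] -/
def wt₂ : κ × (κ × μ) → ℕ := fun p => eA p.1 + eA p.2.1 + eB p.2.2

/-- Torus weight of the `(1,2,0)` coordinate `a_k b_m b_{m'}`. [cite: ConnerHarperLandsberg2023, §2.5] -/
def wt₃ : κ × (μ × μ) → ℕ := fun p => eA p.1 + eB p.2.1 + eB p.2.2

omit [Fintype κ] [Fintype μ] in
/-- Unfolding lemma. [folklore] -/
@[simp] theorem wt₁_apply (k : κ) (m : μ) : wt₁ eA eB (k, m) = eA k + eB m := rfl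

omit [Fintype κ] [Fintype μ] in
/-- Unfolding lemma. [folklore] -/
@[simp] theorem wt₂_apply (k k' : κ) (m : μ) : wt₂ eA eB (k, (k', m)) = eA k + eA k' + eB m := rfl

omit [Fintype κ] [Fintype μ] in
/-- Unfolding lemma. [folklore] -/
@[simp] theorem wt₃_apply (k : κ) (m m' : μ) : wt₃ eA eB (k, (m, m')) = eA k + eB m + eB m' := rfl

end Weights

end TensorApolarity

/-! ## The `2 × 2` data: a separating one-parameter torus and the `12` weight lines -/

namespace MatMulTwo

/-- Weight of the `A*`-coordinate `(i, j)` (exponent of `X_{ij}`) under the one-parameter subgroup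
`(t^{-p_i}, t^{q_j})`, `p = (0,1)`, `q = (0,3)`, shifted to be non-negative: `1 − p_i + q_j`.
[cite: ConnerHarperLandsberg2023, §2.5] -/
def eA2 : Fin 2 × Fin 2 → ℕ
  | (0, 0) => 1
  | (0, 1) => 4
  | (1, 0) => 0
  | (1, 1) => 3

/-- Weight of the `B*`-coordinate `(j', k)`: `3 − q_{j'} + r_k`, `r = (0,9)`.
[cite: ConnerHarperLandsberg2023, §2.5] -/
def eB2 : Fin 2 × Fin 2 → ℕ
  | (0, 0) => 3
  | (0, 1) => 12
  | (1, 0) => 0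
  | (1, 1) => 9

/-- The weight of the `k`-th weight line `wvZ k` of `M⟨2⟩(C*)^⊥` (`BorderRankMatMulTwoCert.lean`)
for `(eA2, eB2)`; the twelve values are pairwise distinct. [cite: ConnerHarperLandsberg2023, §5 (Fig. 1)] -/
def wc (k : Fin 12) : ℕ :=
  match k.val with
  | 0 => 1 | 1 => 7 | 2 => 10 | 3 => 16 | 4 => 0 | 5 => 6 | 6 => 9 | 7 => 15
  | 8 => 4 | 9 => 13 | 10 => 3 | _ => 12

/-- The pivot coordinate of the `k`-th weight line (where `wvZ k` has the entry `1`).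
[cite: ConnerHarperLandsberg2023, §5 (Fig. 1)] -/
def piv (k : Fin 12) : (Fin 2 × Fin 2) × (Fin 2 × Fin 2) :=
  match k.val with
  | 0 => ((0, 0), (1, 0)) | 1 => ((0, 1), (0, 0)) | 2 => ((0, 0), (1, 1)) | 3 => ((0, 1), (0, 1))
  | 4 => ((1, 0), (1, 0)) | 5 => ((1, 1), (0, 0)) | 6 => ((1, 0), (1, 1)) | 7 => ((1, 1), (0, 1))
  | 8 => ((0, 0), (0, 0)) | 9 => ((0, 0), (0, 1)) | 10 => ((1, 0), (0, 0)) | _ => ((1, 0), (0, 1))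

end MatMulTwo

end Literature.Computability.AlgebraicComplexity

end
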